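import Summits.NavierStokesRegularity.NavierStokesRegularity.Theses.RellichScar
import Summits.NavierStokesRegularity.NavierStokesRegularity.Theorems.SymmetricScarExists.Negative.SpiralWorld
import Summits.NavierStokesRegularity.NavierStokesRegularity.Theorems.RellichScarSymmetricScarExistsRdssSlowScrewCorner
import Summits.NavierStokesRegularity.NavierStokesRegularity.Theorems.RellichScarSymmetricScarExistsSlabLimit
import Literature.Analysis.FluidPDE.LocalTypeI
import Literature.Analysis.FluidPDE.LocalTypeICongr
import Literature.Analysis.FluidPDE.SlabTypeICompactness

/-!
# Crux `SymmetricScarExists` (stmt-NavierStokesRegularity-11718), line `rdss-screw-split`: the ROBUST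
# slow-screw corner of child C (`RdssApexFatal`)

Helper file of the line lead (`--supports stmt-NavierStokesRegularity-11718`; theorems only, no definitions, no
named-fact hypotheses).  The landed slow-screw near-identity corner of child C
(`RdssSplit.WallBridge.rdssApexFatal_slowScrew_nearOne`, Pineau–Vicol 2026 Thm 1.7(i)-type / Chae–Wolf 2017
Thm 1.3 in the Albritton–Barker apex class) says: for every rate constant `C` and bound `M < ⊤` on `𝐈` there
are `Λ > 1`, `α_ > 0` such that NO singular apex Type-I profile (`𝐈 ≤ M`, constant `C`) is a.e. fixed on the
slab by a screw-dilation `u ↦ R_θ D_c u ∘ R_{−θ}` with `1 < c < Λ`, `|θ| ≤ α_ log c`.  This file lands its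
ROBUST (`L³_loc`, whole-profile, Chae–Wolf-type "a Type-I singularity cannot NEARLY repeat itself soon")
form:

* `rdss_robustSlowScrew` (registered auxiliary stub): for `(c, θ)` in the same corner (thresholds now those
  of the exact corner at the level `4 M`) there is NO SEQUENCE of singular apex profiles (`𝐈 ≤ M`, constant
  `C`) whose screw defect `‖R_θ D_c v_k ∘ R_{−θ} − v_k‖_{L³(Q(0,R))}` tends to `0` for every `R > 0`.

Proof.  Compactness of singular apex profiles on the slab (Albritton–Barker 2019, Lemma 2.2 + Prop. 2.3;
here `slabLimit_le`, the QUANTITATIVE form `𝐈 ≤ 4 M` of the landed `ScarWindow.stub_slabLimit`) gives an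
`L³(Q(0,R))`-limit `u` (every `R`) in the class, singular at the origin; the screw `w ↦ R_θ D_c w ∘ R_{−θ}` is
linear and multiplies `L³(Q(0,R))`-distances by the exact factor `c (c⁵)^{-1/3}` after enlarging the ball to
`Q(0, cR)` (`eLpNorm_screw_sub_screw`: isometry of the rotated conjugation `rlRotAbs_eLpNorm_conj` + exact
scaling law `eLpNorm_zoom_sub_zoom`), so the defect passes to the limit
(`screw_ae_eq_of_defect_tendsto_zero`, three-term splitting, exhaustion of the slab by the balls
`Q(0, n+1)`): `R_θ D_c u ∘ R_{−θ} = u` a.e. on the slab — contradicting the exact corner.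

References: B. Pineau, V. Vicol, arXiv:2607.09619 (2026), Thm 1.7 [PineauVicol2026]; D. Chae, J. Wolf,
arXiv:1610.09464, Thm 1.3 [ChaeWolf2017RemovingDSS]; D. Albritton, T. Barker, J. Math. Fluid Mech. 21 (2019)
= arXiv:1811.00502, Lemma 2.2, Prop. 2.3 [AlbrittonBarker2019].
-/

noncomputable section

open MeasureTheory Set Function Filter Topology TopologicalSpace Metric
open scoped NNReal ENNReal

namespace Summit.NavierStokesRegularity.NavierStokesRegularity.Theorems.SymmetricScarExists.RdssSplit.Robust

open Literature.Analysis.FluidPDE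
open Summit.NavierStokesRegularity.NavierStokesRegularity.Theses.RellichScar
open Summit.NavierStokesRegularity.NavierStokesRegularity.Theorems.SymmetricScarExists.Negative
open Summit.NavierStokesRegularity.NavierStokesRegularity.Theorems.SymmetricScarExists.ScarWindow
  (ae_apexBound_of_tendsto_eLpNorm)
open Summit.NavierStokesRegularity.NavierStokesRegularity.Theorems.SymmetricScarExists.RdssSplit.WallBridge
  (rdssApexFatal_slowScrew_nearOne)

set_option linter.dupNamespace false

/-- **Compactness of singular apex Type-I profiles on the slab, quantitative form** (Albritton–Barker 2019,
Lemma 2.2 + Prop. 2.3 exhausted to the slab; the landed `ScarWindow.stub_slabLimit` with the bound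
`𝐈 ≤ 4 I` of `slab_typeI_compactness` retained).  A sequence of suitable weak solutions on `(-∞, 0) × ℝ³`
with weak gradients, `𝐈 ≤ I < ∞`, the apex bound `‖v_k(t,x)‖ ≤ C/(‖x‖ + √(−t))` with one constant `C ≥ 0`
and a backward-singular origin subconverges in `L³(Q(0, R))`, every `R > 0`, to a suitable weak solution on
the slab with a weak gradient, `𝐈 ≤ 4 I`, the same pointwise apex bound and a backward-singular origin.
[cite: AlbrittonBarker2019, Lemma 2.2 and Prop. 2.3 (arXiv:1811.00502)] -/
theorem slabLimit_le (C : ℝ) (I : ℝ≥0∞)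
    (v : ℕ → ℝ → EuclideanSpace ℝ (Fin 3) → EuclideanSpace ℝ (Fin 3))
    (q : ℕ → ℝ → EuclideanSpace ℝ (Fin 3) → ℝ)
    (H : ℕ → ℝ → EuclideanSpace ℝ (Fin 3) → EuclideanSpace ℝ (Fin 3) →L[ℝ] EuclideanSpace ℝ (Fin 3))
    (hC : 0 ≤ C) (hI : I < ⊤)
    (h : ∀ k : ℕ, IsSuitableWeakSolutionOn (slab (EuclideanSpace ℝ (Fin 3)) (Iio (0 : ℝ)) isOpen_Iio)
        1 0 (v k) (q k) ∧
      HasWeakSpatialGradientOn (slab (EuclideanSpace ℝ (Fin 3)) (Iio (0 : ℝ)) isOpen_Iio) (v k) (H k) ∧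
      typeIBound (Iio (0 : ℝ) ×ˢ univ) (v k) (q k) (H k) ≤ I ∧ HasTypeIDecay C (v k) ∧
      IsBackwardSingularPoint (v k) 0) :
    ∃ (u : ℝ → EuclideanSpace ℝ (Fin 3) → EuclideanSpace ℝ (Fin 3))
      (p : ℝ → EuclideanSpace ℝ (Fin 3) → ℝ)
      (G : ℝ → EuclideanSpace ℝ (Fin 3) → EuclideanSpace ℝ (Fin 3) →L[ℝ] EuclideanSpace ℝ (Fin 3))
      (φ : ℕ → ℕ), StrictMono φ ∧
      IsSuitableWeakSolutionOn (slab (EuclideanSpace ℝ (Fin 3)) (Iio (0 : ℝ)) isOpen_Iio) 1 0 u p ∧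
      HasWeakSpatialGradientOn (slab (EuclideanSpace ℝ (Fin 3)) (Iio (0 : ℝ)) isOpen_Iio) u G ∧
      typeIBound (Iio (0 : ℝ) ×ˢ univ) u p G ≤ 4 * I ∧ HasTypeIDecay C u ∧
      IsBackwardSingularPoint u 0 ∧
      (∀ R : ℝ, 0 < R → Tendsto (fun j => eLpNorm (uncurry (v (φ j)) - uncurry u) 3
        (volume.restrict (parabolicCylinder R (0 : ℝ × EuclideanSpace ℝ (Fin 3))))) atTop (𝓝 0)) := by
  -- ## Step 1: Albritton–Barker compactness on the slab along a subsequence `φ`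
  obtain ⟨u₀, p, G, φ, hφ, hsw₀, hwg₀, h4I, hconv, hpers⟩ :=
    slab_typeI_compactness I v q H hI (fun k => (h k).1) (fun k => (h k).2.1)
      (fun k => (h k).2.2.1)
  -- ## Step 2: the origin stays singular (every approximant is unbounded on every `Q(0, R)`)
  have hsing₀ : IsBackwardSingularPoint u₀ 0 := by
    refine hpers fun R hR => ?_
    have e : (fun j => eLpNorm (uncurry (v (φ j))) ⊤
        (volume.restrict (parabolicCylinder R (0 : ℝ × EuclideanSpace ℝ (Fin 3))))) =
        fun _ => ⊤ :=
      funext fun j => (h (φ j)).2.2.2.2 R hR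
    rw [e]
    exact limsup_const ⊤
  -- ## Step 3: the apex bound almost everywhere on the slab
  have hapex : ∀ᵐ w ∂(volume.restrict (Iio (0 : ℝ) ×ˢ (univ : Set (EuclideanSpace ℝ (Fin 3))))),
      ‖u₀ w.1 w.2‖ ≤ C / (‖w.2‖ + Real.sqrt (-w.1)) := by
    refine ae_restrict_of_ae_restrict_of_subset
      Summit.NavierStokesRegularity.NavierStokesRegularity.Theorems.lowerHalf_subset_iUnion_parabolicCylinder ?_
    rw [ae_restrict_iUnion_iff]
    intro n
    have hQs : parabolicCylinder ((n : ℝ) + 1) (0 : ℝ × EuclideanSpace ℝ (Fin 3)) ⊆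
        Iio (0 : ℝ) ×ˢ (univ : Set (EuclideanSpace ℝ (Fin 3))) :=
      parabolicCylinder_origin_subset_slab _
    have hVm : ∀ j, AEStronglyMeasurable (uncurry (v (φ j)))
        (volume.restrict (parabolicCylinder ((n : ℝ) + 1) (0 : ℝ × EuclideanSpace ℝ (Fin 3)))) :=
      fun j => (h (φ j)).2.1.locallyIntegrableOn.aestronglyMeasurable.mono_measure
        (Measure.restrict_mono hQs le_rfl)
    have hum : AEStronglyMeasurable (uncurry u₀)
        (volume.restrict (parabolicCylinder ((n : ℝ) + 1) (0 : ℝ × EuclideanSpace ℝ (Fin 3)))) :=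
      hwg₀.locallyIntegrableOn.aestronglyMeasurable.mono_measure (Measure.restrict_mono hQs le_rfl)
    exact ae_apexBound_of_tendsto_eLpNorm hVm hum (hconv _ (by positivity))
      fun j => (h (φ j)).2.2.2.1
  -- ## Step 4: a representative with the pointwise apex bound (same `p`, `G`, same `𝐈`)
  obtain ⟨u, hae, hdec⟩ := exists_repr_hasTypeIDecay hC hapex
  have hae' : ∀ᵐ w ∂(volume.restrict ((slab (EuclideanSpace ℝ (Fin 3)) (Iio (0 : ℝ)) isOpen_Iio :
      Opens (ℝ × EuclideanSpace ℝ (Fin 3))) : Set (ℝ × EuclideanSpace ℝ (Fin 3)))),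
      uncurry u₀ w = uncurry u w := by
    rw [coe_slab]
    exact hae
  refine ⟨u, p, G, φ, hφ, hsw₀.congr_ae hae' (ae_of_all _ fun _ => rfl), hwg₀.congr_ae hae', ?_, hdec,
    hsing₀.congr_ae (fun r _ => parabolicCylinder_origin_subset_slab r) hae, fun R hR => ?_⟩
  · rw [← typeIBound_congr_ae hae]
    exact h4I
  · have haeR : ∀ᵐ w ∂(volume.restrict (parabolicCylinder R (0 : ℝ × EuclideanSpace ℝ (Fin 3)))),
        uncurry u₀ w = uncurry u w :=
      ae_restrict_of_ae_restrict_of_subset (parabolicCylinder_origin_subset_slab R) hae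
    refine (hconv R hR).congr fun j => eLpNorm_congr_ae ?_
    filter_upwards [haeR] with w hw
    simp only [Pi.sub_apply, hw]

/-- **The screw multiplies `L³(Q(0,R))`-distances by the exact scaling factor**: for `c > 0` and any `θ`,
`‖R_θ D_c f ∘ R_{−θ} − R_θ D_c g ∘ R_{−θ}‖_{L³(Q(0,R))} = c (c⁵)^{-1/3} ‖f − g‖_{L³(Q(0, cR))}` (isometry of
the rotated conjugation, `Q(0,R)` being rotation invariant, and the exact parabolic scaling law). [folklore] -/
theorem eLpNorm_screw_sub_screw {c : ℝ} (hc : 0 < c) (θ R : ℝ)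
    {f g : ℝ → EuclideanSpace ℝ (Fin 3) → EuclideanSpace ℝ (Fin 3)}
    (hf : AEStronglyMeasurable (uncurry (nsRescale c f))
      (volume.restrict (parabolicCylinder R (0 : ℝ × EuclideanSpace ℝ (Fin 3)))))
    (hg : AEStronglyMeasurable (uncurry (nsRescale c g))
      (volume.restrict (parabolicCylinder R (0 : ℝ × EuclideanSpace ℝ (Fin 3))))) :
    eLpNorm (uncurry (fun t x => rotZ θ (nsRescale c f t (rotZ (-θ) x))) -
        uncurry (fun t x => rotZ θ (nsRescale c g t (rotZ (-θ) x)))) 3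
        (volume.restrict (parabolicCylinder R (0 : ℝ × EuclideanSpace ℝ (Fin 3)))) =
      ‖c‖ₑ * (ENNReal.ofReal (c ^ 2 * c ^ 3)⁻¹) ^ (1 / (3 : ℝ≥0∞).toReal) *
        eLpNorm (uncurry f - uncurry g) 3
          (volume.restrict (parabolicCylinder (c * R) (0 : ℝ × EuclideanSpace ℝ (Fin 3)))) := by
  have h1 := rlRotAbs_eLpNorm_conj θ R hf hg
  have e : uncurry (fun t x => rotZ θ (nsRescale c f t (rotZ (-θ) x))) -
      uncurry (fun t x => rotZ θ (nsRescale c g t (rotZ (-θ) x))) =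
      fun z : ℝ × EuclideanSpace ℝ (Fin 3) =>
        rotZ θ (uncurry (nsRescale c f) (z.1, rotZ (-θ) z.2)) -
          rotZ θ (uncurry (nsRescale c g) (z.1, rotZ (-θ) z.2)) := rfl
  rw [e, h1, nsRescale_eq_zoom, nsRescale_eq_zoom, eLpNorm_zoom_sub_zoom _ _ hc R]

/-- **The screw defect passes to `L³_loc` limits.**  If `V_j → u` in `L³(Q(0,R))` for every `R > 0` and
the screw defects `‖R_θ D_c V_j ∘ R_{−θ} − V_j‖_{L³(Q(0,R))}` tend to `0` for every `R > 0` (`c > 0`), then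
`R_θ D_c u ∘ R_{−θ} = u` a.e. on the slab `(-∞,0) × ℝ³`: on each ball
`‖R_θ D_c u ∘ R_{−θ} − u‖ ≤ c(c⁵)^{-1/3} ‖u − V_j‖_{L³(Q(0,cR))} + ‖R_θ D_c V_j ∘ R_{−θ} − V_j‖ + ‖V_j − u‖ → 0`,
and the balls `Q(0, n+1)` exhaust the slab. [folklore] -/
theorem screw_ae_eq_of_defect_tendsto_zero {c θ : ℝ} (hc : 0 < c)
    {V : ℕ → ℝ → EuclideanSpace ℝ (Fin 3) → EuclideanSpace ℝ (Fin 3)}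
    {u : ℝ → EuclideanSpace ℝ (Fin 3) → EuclideanSpace ℝ (Fin 3)}
    (hVm : ∀ (j : ℕ) (r : ℝ), 0 < r → ∀ R : ℝ, 0 < R → AEStronglyMeasurable (uncurry (nsRescale r (V j)))
      (volume.restrict (parabolicCylinder R (0 : ℝ × EuclideanSpace ℝ (Fin 3)))))
    (hum : ∀ (r : ℝ), 0 < r → ∀ R : ℝ, 0 < R → AEStronglyMeasurable (uncurry (nsRescale r u))
      (volume.restrict (parabolicCylinder R (0 : ℝ × EuclideanSpace ℝ (Fin 3)))))
    (hconv : ∀ R : ℝ, 0 < R → Tendsto (fun j => eLpNorm (uncurry (V j) - uncurry u) 3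
      (volume.restrict (parabolicCylinder R (0 : ℝ × EuclideanSpace ℝ (Fin 3))))) atTop (𝓝 0))
    (hdef : ∀ R : ℝ, 0 < R → Tendsto (fun j => eLpNorm
      (uncurry (fun t x => rotZ θ (nsRescale c (V j) t (rotZ (-θ) x))) - uncurry (V j)) 3
      (volume.restrict (parabolicCylinder R (0 : ℝ × EuclideanSpace ℝ (Fin 3))))) atTop (𝓝 0)) :
    uncurry (fun t x => rotZ θ (nsRescale c u t (rotZ (-θ) x)))
      =ᵐ[volume.restrict (Iio (0 : ℝ) ×ˢ (univ : Set (EuclideanSpace ℝ (Fin 3))))] uncurry u := by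
  have h13 : (1 : ℝ≥0∞) ≤ 3 := by norm_num
  -- unscaled measurability
  have hum1 : ∀ R : ℝ, 0 < R → AEStronglyMeasurable (uncurry u)
      (volume.restrict (parabolicCylinder R (0 : ℝ × EuclideanSpace ℝ (Fin 3)))) := by
    intro R hR
    have h := hum 1 one_pos R hR
    rwa [nsRescale_one] at h
  have hVm1 : ∀ (j : ℕ) (R : ℝ), 0 < R → AEStronglyMeasurable (uncurry (V j))
      (volume.restrict (parabolicCylinder R (0 : ℝ × EuclideanSpace ℝ (Fin 3)))) := by
    intro j R hR
    have h := hVm j 1 one_pos R hR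
    rwa [nsRescale_one] at h
  -- the statement on every ball
  have hball : ∀ R : ℝ, 0 < R →
      ∀ᵐ z ∂(volume.restrict (parabolicCylinder R (0 : ℝ × EuclideanSpace ℝ (Fin 3)))),
        uncurry (fun t x => rotZ θ (nsRescale c u t (rotZ (-θ) x))) z = uncurry u z := by
    intro R hR
    set μR : Measure (ℝ × EuclideanSpace ℝ (Fin 3)) :=
      volume.restrict (parabolicCylinder R (0 : ℝ × EuclideanSpace ℝ (Fin 3))) with hμR
    set Su : ℝ × EuclideanSpace ℝ (Fin 3) → EuclideanSpace ℝ (Fin 3) :=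
      uncurry (fun t x => rotZ θ (nsRescale c u t (rotZ (-θ) x))) with hSu
    set SV : ℕ → ℝ × EuclideanSpace ℝ (Fin 3) → EuclideanSpace ℝ (Fin 3) :=
      fun j => uncurry (fun t x => rotZ θ (nsRescale c (V j) t (rotZ (-θ) x))) with hSV
    have hSum : AEStronglyMeasurable Su μR :=
      rlRotAbs_aesm_conj θ R (g := uncurry (nsRescale c u)) (hum c hc R hR)
    have hSVm : ∀ j, AEStronglyMeasurable (SV j) μR := fun j =>
      rlRotAbs_aesm_conj θ R (g := uncurry (nsRescale c (V j))) (hVm j c hc R hR)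
    have hUm : AEStronglyMeasurable (uncurry u) μR := hum1 R hR
    have hVjm : ∀ j, AEStronglyMeasurable (uncurry (V j)) μR := fun j => hVm1 j R hR
    -- the three-term bound
    have hle : ∀ j, eLpNorm (Su - uncurry u) 3 μR ≤
        ‖c‖ₑ * (ENNReal.ofReal (c ^ 2 * c ^ 3)⁻¹) ^ (1 / (3 : ℝ≥0∞).toReal) *
            eLpNorm (uncurry (V j) - uncurry u) 3
              (volume.restrict (parabolicCylinder (c * R) (0 : ℝ × EuclideanSpace ℝ (Fin 3)))) +
          (eLpNorm (SV j - uncurry (V j)) 3 μR + eLpNorm (uncurry (V j) - uncurry u) 3 μR) := by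
      intro j
      have e : Su - uncurry u = (Su - SV j) + ((SV j - uncurry (V j)) + (uncurry (V j) - uncurry u)) := by
        rw [sub_add_sub_cancel, sub_add_sub_cancel]
      have hA : eLpNorm (Su - SV j) 3 μR =
          ‖c‖ₑ * (ENNReal.ofReal (c ^ 2 * c ^ 3)⁻¹) ^ (1 / (3 : ℝ≥0∞).toReal) *
            eLpNorm (uncurry (V j) - uncurry u) 3
              (volume.restrict (parabolicCylinder (c * R) (0 : ℝ × EuclideanSpace ℝ (Fin 3)))) := by
        rw [hSu, hSV, hμR, eLpNorm_screw_sub_screw hc θ R (hum c hc R hR) (hVm j c hc R hR),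
          eLpNorm_sub_comm]
      calc eLpNorm (Su - uncurry u) 3 μR
          ≤ eLpNorm (Su - SV j) 3 μR + eLpNorm ((SV j - uncurry (V j)) + (uncurry (V j) - uncurry u)) 3 μR := by
            rw [e]
            exact eLpNorm_add_le (hSum.sub (hSVm j)) (((hSVm j).sub (hVjm j)).add ((hVjm j).sub hUm)) h13
        _ ≤ _ := by
            rw [hA]
            exact add_le_add le_rfl (eLpNorm_add_le ((hSVm j).sub (hVjm j)) ((hVjm j).sub hUm) h13)
    -- the three terms tend to zero
    have hA : Tendsto (fun j => ‖c‖ₑ * (ENNReal.ofReal (c ^ 2 * c ^ 3)⁻¹) ^ (1 / (3 : ℝ≥0∞).toReal) *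
        eLpNorm (uncurry (V j) - uncurry u) 3
          (volume.restrict (parabolicCylinder (c * R) (0 : ℝ × EuclideanSpace ℝ (Fin 3))))) atTop (𝓝 0) := by
      have h := ENNReal.Tendsto.const_mul (hconv (c * R) (by positivity)) (Or.inr (zoomConst_ne_top c))
        (a := ‖c‖ₑ * (ENNReal.ofReal (c ^ 2 * c ^ 3)⁻¹) ^ (1 / (3 : ℝ≥0∞).toReal))
      rwa [mul_zero] at h
    have hB : Tendsto (fun j => eLpNorm (SV j - uncurry (V j)) 3 μR) atTop (𝓝 0) := hdef R hR
    have hlim := hA.add (hB.add (hconv R hR))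
    rw [add_zero, add_zero] at hlim
    have h0 : eLpNorm (Su - uncurry u) 3 μR = 0 := le_antisymm (ge_of_tendsto' hlim hle) zero_le
    rw [eLpNorm_eq_zero_iff (hSum.sub hUm) (by norm_num)] at h0
    filter_upwards [h0] with z hz
    rw [Pi.sub_apply, Pi.zero_apply, sub_eq_zero] at hz
    exact hz
  -- exhaustion of the slab by the balls `Q(0, n+1)`
  refine ae_restrict_of_ae_restrict_of_subset
    Summit.NavierStokesRegularity.NavierStokesRegularity.Theorems.lowerHalf_subset_iUnion_parabolicCylinder ?_
  rw [ae_restrict_iUnion_iff]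
  intro n
  exact hball _ (by positivity)

/-- **No `L³_loc`-approximately slow-screw-periodic sequence of singular apex profiles** (registered auxiliary
stub `rdss_robustSlowScrew` of crux stmt-NavierStokesRegularity-11718, line rdss-screw-split; the ROBUST form of
the slow-screw near-identity corner `rdssApexFatal_slowScrew_nearOne` of child C, Pineau–Vicol 2026
Thm 1.7(i)-type / Chae–Wolf 2017 Thm 1.3 in the apex class: "a Type-I singularity cannot nearly repeat itself
soon").  For every `C` and every `M < ⊤` there are `Λ > 1`, `α_ > 0` such that for `1 < c < Λ` and
`|θ| ≤ α_ log c` there is no sequence `(v_k, q_k, H_k)` of suitable weak solutions on the slab with weak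
gradients, `𝐈 ≤ M`, the apex bound `‖v_k‖ ≤ C/(‖x‖ + √(−t))` and a singular origin whose screw defects
`‖R_θ (c v_k(c²t, c R_{−θ} x)) − v_k(t, x)‖_{L³(Q(0,R))}` tend to `0` for every `R > 0`: a subsequence
converges in every `L³(Q(0,R))` to a singular apex profile with `𝐈 ≤ 4M` (`slabLimit_le`), which is then
exactly screw-invariant a.e. on the slab (`screw_ae_eq_of_defect_tendsto_zero`), contradicting the exact
corner at the level `4M`. [cite: PineauVicol2026, Theorem 1.7 (arXiv:2607.09619 p. 5)] -/
theorem rdss_robustSlowScrew :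
    ∀ (C : ℝ) (M : ENNReal), M < ⊤ → ∃ Λ αlow : ℝ, 1 < Λ ∧ 0 < αlow ∧ ∀ (c θ : ℝ), 1 < c → c < Λ → |θ| ≤ αlow * Real.log c → ∀ (v : ℕ → ℝ → EuclideanSpace ℝ (Fin 3) → EuclideanSpace ℝ (Fin 3)) (q : ℕ → ℝ → EuclideanSpace ℝ (Fin 3) → ℝ) (H : ℕ → ℝ → EuclideanSpace ℝ (Fin 3) → EuclideanSpace ℝ (Fin 3) →L[ℝ] EuclideanSpace ℝ (Fin 3)), (∀ k : ℕ, IsSuitableWeakSolutionOn (slab (EuclideanSpace ℝ (Fin 3)) (Iio 0) isOpen_Iio) 1 0 (v k) (q k) ∧ HasWeakSpatialGradientOn (slab (EuclideanSpace ℝ (Fin 3)) (Iio 0) isOpen_Iio) (v k) (H k) ∧ typeIBound (Iio (0 : ℝ) ×ˢ univ) (v k) (q k) (H k) ≤ M ∧ HasTypeIDecay C (v k) ∧ IsBackwardSingularPoint (v k) 0) → (∀ R : ℝ, 0 < R → Tendsto (fun k => eLpNorm (uncurry (fun t x => rotZ θ (nsRescale c (v k) t (rotZ (-θ) x))) - uncurry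 (v k)) 3 (volume.restrict (parabolicCylinder R (0 : ℝ × EuclideanSpace ℝ (Fin 3))))) atTop (nhds 0)) → False := by
  intro C M hM
  -- thresholds of the exact corner at the limit's level `4M`
  have hM4 : 4 * M < ⊤ := ENNReal.mul_lt_top (by simp) hM
  obtain ⟨Λ, αlow, hΛ, hα, Hc⟩ := rdssApexFatal_slowScrew_nearOne C (4 * M) hM4
  refine ⟨Λ, αlow, hΛ, hα, fun c θ h1 h2 hθ v q H hfam hdef => ?_⟩
  rcases lt_or_ge C 0 with hC | hC
  · -- a negative constant: the class is empty
    have h := (hfam 0).2.2.2.1 (-1) (by norm_num) 0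
    rw [norm_zero, neg_neg, Real.sqrt_one, zero_add, div_one] at h
    linarith [norm_nonneg (v 0 (-1) 0)]
  · -- a singular apex `L³_loc`-limit with `𝐈 ≤ 4M`
    obtain ⟨u, p, G, φ, hφ, hsw, hwg, hI, hdec, hsing, hconv⟩ := slabLimit_le C M v q H hC hM hfam
    have hc : 0 < c := zero_lt_one.trans h1
    refine Hc c θ h1 h2 hθ u p G hsw hwg hI hdec hsing ?_
    -- measurability of the (rescaled) profiles on the balls
    have hVm : ∀ (j : ℕ) (r : ℝ), 0 < r → ∀ R : ℝ, 0 < R →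
        AEStronglyMeasurable (uncurry (nsRescale r (v (φ j))))
          (volume.restrict (parabolicCylinder R (0 : ℝ × EuclideanSpace ℝ (Fin 3)))) := by
      intro j r hr R _
      rw [nsRescale_eq_zoom]
      exact (zoom_slabProfile (hfam (φ j)).1 (hfam (φ j)).2.1 hr).2.1.locallyIntegrableOn
        |>.aestronglyMeasurable.mono_measure
          (Measure.restrict_mono (parabolicCylinder_origin_subset_slab _) le_rfl)
    have hum : ∀ (r : ℝ), 0 < r → ∀ R : ℝ, 0 < R →
        AEStronglyMeasurable (uncurry (nsRescale r u))
          (volume.restrict (parabolicCylinder R (0 : ℝ × EuclideanSpace ℝ (Fin 3)))) := by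
      intro r hr R _
      rw [nsRescale_eq_zoom]
      exact (zoom_slabProfile hsw hwg hr).2.1.locallyIntegrableOn.aestronglyMeasurable.mono_measure
        (Measure.restrict_mono (parabolicCylinder_origin_subset_slab _) le_rfl)
    exact screw_ae_eq_of_defect_tendsto_zero hc hVm hum hconv
      fun R hR => (hdef R hR).comp hφ.tendsto_atTop

/-- **A positive `L³_loc` distance from slow screw-periodicity** (ε-form of `rdss_robustSlowScrew`): for
every `C`, `M < ⊤` and every screw `(c, θ)` in the slow near-identity corner there are ONE ball `Q(0,R)` and
a `δ > 0` such that every singular apex profile (`𝐈 ≤ M`, constant `C`) has screw defect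
`‖R_θ (c u(c²t, c R_{−θ} x)) − u(t, x)‖_{L³(Q(0,R))} ≥ δ`.  (Otherwise the balls `Q(0, n+1)` and `δ = 1/(n+1)`
produce a sequence whose defect tends to `0` in every `L³(Q(0,R))`, by monotonicity of the norm in the ball.)
[cite: PineauVicol2026, Theorem 1.7 (arXiv:2607.09619 p. 5)] -/
theorem rdss_robustSlowScrew_quantitative :
    ∀ (C : ℝ) (M : ENNReal), M < ⊤ → ∃ Λ αlow : ℝ, 1 < Λ ∧ 0 < αlow ∧ ∀ (c θ : ℝ), 1 < c → c < Λ → |θ| ≤ αlow * Real.log c → ∃ R : ℝ, 0 < R ∧ ∃ δ : ℝ, 0 < δ ∧ ∀ (u : ℝ → EuclideanSpace ℝ (Fin 3) → EuclideanSpace ℝ (Fin 3)) (p : ℝ → EuclideanSpace ℝ (Fin 3) → ℝ) (G : ℝ → EuclideanSpace ℝ (Fin 3) → EuclideanSpace ℝ (Fin 3) →L[ℝ] EuclideanSpace ℝ (Fin 3)), IsSuitableWeakSolutionOn (slab (EuclideanSpace ℝ (Fin 3)) (Iio 0) isOpen_Iio) 1 0 u p → HasWeakSpatialGradientOn (slab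 (EuclideanSpace ℝ (Fin 3)) (Iio 0) isOpen_Iio) u G → typeIBound (Iio (0 : ℝ) ×ˢ univ) u p G ≤ M → HasTypeIDecay C u → IsBackwardSingularPoint u 0 → ENNReal.ofReal δ ≤ eLpNorm (uncurry (fun t x => rotZ θ (nsRescale c u t (rotZ (-θ) x))) - uncurry u) 3 (volume.restrict (parabolicCylinder R (0 : ℝ × EuclideanSpace ℝ (Fin 3)))) := by
  intro C M hM
  obtain ⟨Λ, αlow, hΛ, hα, Hc⟩ := rdss_robustSlowScrew C M hM
  refine ⟨Λ, αlow, hΛ, hα, fun c θ h1 h2 hθ => ?_⟩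
  by_contra hcon
  push Not at hcon
  have hpos : ∀ n : ℕ, (0 : ℝ) < (n : ℝ) + 1 := fun n => by positivity
  choose u p G hsw hwg hI hdec hsing hlt using
    fun n : ℕ => hcon ((n : ℝ) + 1) (hpos n) (1 / ((n : ℝ) + 1)) (by positivity)
  refine Hc c θ h1 h2 hθ u p G (fun k => ⟨hsw k, hwg k, hI k, hdec k, hsing k⟩) fun R hR => ?_
  -- on `Q(0,R) ⊆ Q(0,k+1)` (`k + 1 ≥ R`) the defect is below `1/(k+1) → 0`
  obtain ⟨N, hN⟩ := exists_nat_ge R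
  have hev : ∀ᶠ k : ℕ in atTop,
      eLpNorm (uncurry (fun t x => rotZ θ (nsRescale c (u k) t (rotZ (-θ) x))) - uncurry (u k)) 3
        (volume.restrict (parabolicCylinder R (0 : ℝ × EuclideanSpace ℝ (Fin 3)))) ≤
        ENNReal.ofReal (1 / ((k : ℝ) + 1)) := by
    filter_upwards [eventually_ge_atTop N] with k hk
    have hRk : R ≤ (k : ℝ) + 1 := by
      have hNk : (N : ℝ) ≤ k := by exact_mod_cast hk
      linarith
    exact (eLpNorm_mono_measure _ (Measure.restrict_mono
      (SuitableCompactness.parabolicCylinder_zero_mono hR.le hRk) le_rfl)).trans (hlt k).le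
  have h0 : Tendsto (fun k : ℕ => ENNReal.ofReal (1 / ((k : ℝ) + 1))) atTop (𝓝 0) := by
    have h := ENNReal.tendsto_ofReal (tendsto_one_div_add_atTop_nhds_zero_nat (𝕜 := ℝ))
    rwa [ENNReal.ofReal_zero] at h
  exact tendsto_of_tendsto_of_tendsto_of_le_of_le' tendsto_const_nhds h0
    (Eventually.of_forall fun _ => zero_le) hev

end Summit.NavierStokesRegularity.NavierStokesRegularity.Theorems.SymmetricScarExists.RdssSplit.Robust

end
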